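import Literature.Computability.Complexity.CodeFPBudgets
import HarnessLib

/-!
# Typed polynomial time on codes: bit strings, bit access, sums

Trunk `CplxCore`, a small kit file above `CodeFP.lean` / `CodeFPArith.lean` / `CodeFPBudgets.lean`
collecting generic combinators that several client files of the `CodeFP` algebra had each re-proved
privately (the canonical home is here; the client copies —
`KSatSNP.strGetD/strGetDNat/codeFP_hdrBody` of `FineGrained/SerfSNPInSNPProofs.lean`,
`SumcheckMA.bitsToStr`, `IKWGenM.bitsToStr`, `HiraharaMachine.natSum/unSum`, `BT.natSum` — are
byte-near twins to be retired into aliases of these):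

* `strGetD` / `strGetDNat` — bit access in a string by a unary / binary position (`false` past the
  end);
* `codeFP_hdrBody` — a string read as the pair `(value of its first field, its second field)`, the
  first step of every parser of a `boolPair`-headed code;
* `bitsToStr` — the change of code `rawE bitE → strE` (a raw list of bits as the bit string);
* `natSum`, `unSum` — sums of raw lists of binary / unary numerals; `unMulConst c` — `1ⁿ ↦ 1^{cn}`.

First client: the gadget reduction `CSP(pp-power) ≤ₚ CSP(template)` of
`ModelTheory/FiniteModelTheory/PPGadgetCode.lean`.

## References

* S. Arora, B. Barak, *Computational Complexity: A Modern Approach*, CUP 2009, §1.3 (closure of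
  polynomial time under composition and polynomially bounded loops), §0.1 (codes).
-/

namespace Literature.Computability.Complexity

namespace CodeFP

open _root_.Computability Polynomial Brick

/-! ### Bit access -/

/-- **Bit access by a unary position**: `(1ⁱ, w) ↦ w[i]` (`false` past the end).
[cite: AroraBarak2009, §1.3] -/
theorem strGetD : CodeFP (pairE unE strE) bitE (fun p => p.2.getD p.1 false) :=
  ⟨HashBricks.headBitFn ∘ bitAtFn, comp_mem_FP HashBricks.headBitFn_mem_FP bitAtFn_mem_FP, fun p => by
    rw [pairE_apply, Function.comp_apply, bitAtFn_boolPair, HashBricks.headBitFn_apply, length_unE]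
    change [((p.2.drop p.1).take 1).headD false] = [p.2.getD p.1 false]
    rw [List.getD_eq_getElem?_getD, ← List.head?_drop]
    cases p.2.drop p.1 <;> rfl⟩

/-- **Bit access by a binary position**: `(w, i) ↦ w[i]` (`false` past the end; the position is
capped by `|w|` in unary first). [cite: AroraBarak2009, §1.3] -/
theorem strGetDNat : CodeFP (pairE strE natE) bitE (fun p => p.1.getD p.2 false) :=
  (strGetD.comp ((unOfNatMin.comp ((strLength.comp (fst strE natE)).pair (snd strE natE))).pair
    (fst strE natE))).congr fun p => by
      obtain ⟨w, i⟩ := p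
      simp only
      by_cases h : i < w.length
      · rw [min_eq_left h.le]
      · push Not at h
        rw [min_eq_right h, List.getD_eq_default _ _ le_rfl, List.getD_eq_default _ _ h]

/-- **The header numeral and the body of a string**: `w ↦ (⟦fstF w⟧, sndF w)` (binary value of the
first field, the second field). [cite: AroraBarak2009, §0.1] -/
theorem codeFP_hdrBody : CodeFP strE (pairE natE strE) (fun w => (bitsToNat (fstF w), sndF w)) :=
  (strVal.comp (of_fn (eα := strE) (eβ := strE) (g := fstF) fstF fstF_mem_FP fun _ => rfl)).pair
    (of_fn (eα := strE) (eβ := strE) (g := sndF) sndF sndF_mem_FP fun _ => rfl)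

/-! ### Bit lists as strings -/

/-- The appending fold rebuilds the list. [folklore] -/
theorem foldl_append_singleton_self {α : Type} (l acc : List α) :
    l.foldl (fun acc b => acc ++ [b]) acc = acc ++ l := by
  induction l generalizing acc with
  | nil => simp
  | cons b l ih => rw [List.foldl_cons, ih]; simp

/-- **A raw list of bits as a bit string** (change of code `rawE bitE → strE`).
[cite: AroraBarak2009, §1.3] -/
theorem bitsToStr : CodeFP (rawE bitE) strE (fun l => l) := by
  have hsing : CodeFP bitE strE (fun b : Bool => [b]) := ⟨_root_.id, PolyTimeComputable.id _, fun _ => rfl⟩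
  have hstep : CodeFP (pairE bitE strE) strE (fun t => t.2 ++ [t.1]) :=
    (strAppend.comp ((snd _ _).pair (hsing.comp (fst _ _))) :)
  have h := foldl₀ (step := fun (b : Bool) (acc : List Bool) => acc ++ [b]) (b₀ := []) hstep X
    (fun l₁ l₂ => by
      rw [foldl_append_singleton_self, List.nil_append, eval_X]
      have h1 := length_le_length_rawE bitE (l₁ ++ l₂)
      rw [List.length_append] at h1
      change l₁.length ≤ _
      omega)
  exact h.congr fun l => by rw [foldl_append_singleton_self, List.nil_append]

/-! ### Sums -/

/-- **Sums of raw lists of binary numerals** (through the integer sum `intSum`).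
[cite: AroraBarak2009, §1.3] -/
theorem natSum : CodeFP (rawE natE) natE List.sum := by
  have h := intToNat.comp (intSum.comp (map₀ intOfNat))
  refine h.congr fun l => ?_
  show ((l.map fun n : ℕ => (n : ℤ)).sum).toNat = l.sum
  rw [← Nat.cast_list_sum, Int.toNat_natCast]

/-- The adding fold is the sum; an instance of core's `List.foldl_eq_apply_foldr`, kept as a
one-line restatement in `List.sum` form for the `rw`s below (dedup-00799). [folklore] -/
theorem foldl_add_eq_add_sum (l : List ℕ) (k : ℕ) : l.foldl (fun k a => k + a) k = k + l.sum :=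
  List.foldl_eq_apply_foldr

/-- A raw list of unary numerals is at least as long as its sum. [folklore] -/
theorem sum_le_length_rawE_unE : ∀ l : List ℕ, l.sum ≤ (rawE unE l).length
  | [] => by simp
  | a :: l => by
    rw [List.sum_cons, rawE_cons, length_boolPair, length_unE]
    have := sum_le_length_rawE_unE l
    omega

/-- **Sums of raw lists of unary numerals**, in unary. [cite: AroraBarak2009, §1.3] -/
theorem unSum : CodeFP (rawE unE) unE List.sum := by
  have h := foldl₀ (eα := unE) (step := fun (a : ℕ) (k : ℕ) => k + a) (b₀ := 0)
    (unAdd.comp ((snd unE unE).pair (fst unE unE))) X (fun l₁ l₂ => by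
      rw [foldl_add_eq_add_sum, zero_add, length_unE, eval_X]
      exact (sum_le_length_rawE_unE l₁).trans
        (length_rawE_le_of_sublist unE (List.sublist_append_left l₁ l₂)))
  exact h.congr fun l => by rw [foldl_add_eq_add_sum, zero_add]

/-- **Multiplication of a unary numeral by a constant**: `1ⁿ ↦ 1^{cn}`. [cite: AroraBarak2009, §1.3] -/
theorem unMulConst : ∀ c : ℕ, CodeFP unE unE (fun n => c * n)
  | 0 => (const unE 0).congr fun n => by simp
  | c + 1 => (unAdd.comp ((unMulConst c).pair (CodeFP.id unE))).congr fun n => by simp [add_mul]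

end CodeFP

end Literature.Computability.Complexity
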